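/-
Copyright (c) 2026. All rights reserved.
Released under Apache 2.0 license as described in the file LICENSE.
Authors: abc-iut cell, prover seat abc-iut-f-101 (gen 5; row «SB′-D2», abc-iut-L4-lead m136), over the statement of
abc-iut-w5-d144 (`LogFrobeniusMonoTelecoreObservables`, p484312) and its embedding lemmas (`…Emb`, `…EmbTS`), the generic
toolkits `DiagramSinkSystems` / `DiagramPathEmbeddings` (this seat), `DiagramChainFamiliesTwoSided` (abc-iut-w5-d144),
`DiagramOverHomotopies` (abc-iut-w6-d025), abc-iut-L4-t5's universal families, abc-iut-w5-d053's `pushFamily`, and this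
seat's gen-2 telecore `monoTelecore` — nothing of those files is re-meant.
-/
import Literature.AnabelianGeometry.AbsoluteAnabelian.Ltimes.LogFrobeniusMonoTelecoreObservablesEmb
import Literature.AnabelianGeometry.AbsoluteAnabelian.Ltimes.LogFrobeniusMonoTelecoreObservablesEmbTS
import Literature.AnabelianGeometry.AbsoluteAnabelian.Ltimes.LogFrobeniusMonoTelecoreOver
import Literature.AnabelianGeometry.AbsoluteAnabelian.Ltimes.LogFrobeniusObservablesTSOfPlus
import Literature.AnabelianGeometry.AbsoluteAnabelian.DiagramShiftInvariance
import HarnessLib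
import Literature.AnabelianGeometry.AbsoluteAnabelian.LogFrobeniusMonoTelecoreObservablesShape

/-!
# [AbsTopIII] Cor 5.10 (iv)(b), last sentence — sufficiency, part 1/3: the shape of `D_{An⊢}` and the embedded observables

S. Mochizuki, *Topics in absolute anabelian geometry III: global reconstruction algorithms*,
J. Math. Sci. Univ. Tokyo 22 (2015) 939–1156 [MochizukiAbsTopIII2015]; locators `p.N` = pages of the author's manuscript
(`paper:url-5493eb38cbb7`), read on the page: Cor 5.10 (iv)(b) pp. 147–148 ("… give rise to a telecore structure `𝔗_{An⊢}` on
`D•⊢_{≤5} ∪ D•_{≤6}` … Moreover, the respective family of homotopies of `𝔗_{An⊢}` and the observables `S_log`, `S_log⊞` of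
Corollary 5.5, (iii), are compatible"), Def 3.5 (ii) p. 75 ("compatible": contained in ONE family with the same homotopies),
Rmk 3.5.1 p. 78 (a core as "a sort of 'constant portion' of the diagram that lies, in a consistent fashion, 'under the entire
diagram'").

PROOF-SIDE companion (part 1 of 3) of abc-iut-w5-d144's `Cor510MonoTelecoreObservablesCompatible` (`s_b′`, p484312; nothing
there is restated), preparing the abstract sufficiency theorem `cor510MonoTelecoreObservablesCompatible_of`
(`LogFrobeniusMonoTelecoreObservablesOf.lean`, spec `COR510iv-SBprime-CLOSER-SPEC.md` §6 brick D2):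

* the combinatorics of `Γ⃗_{D_{An⊢}}` — the flagged vertices `An⊢`, `𝒩⊞_v`, `𝒩_v` of the sink system (`isObsMono`) and a RANK
  function increasing along the arrows (`rank`, `rank_le_of_path`, `length_eq_zero_of_rank`, `false_of_path_obs`: no arrow of
  `D•⊢` returns towards `□`, `𝒩⊞_v`, `𝒩_v`; nothing leaves the mono-analytic side);
* the observables' diagrams as pull-backs of `D_{An⊢}` (abc-iut-w5-d144's `logDiagramPlus_eq_comapAlong_embMonoPlus` at the
  printed telecore edges) and a family `Hplus v` / `Hts v` read on them (`plusComap`, `tsComap`), its homotopies read on the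
  path functors of `D_{An⊢}` (`embPlusHom`, `embTSHom`, with `…_app_heq`: same components);
* the embedded `⊞`-paths pushed along `𝒩⊞_v → 𝒩_v` (`embMonoTS_mapPath_push`: `embMonoTS ∘ plusToTS = embMonoPlus` on paths).

OUR kernel bookkeeping over a typed interface; nothing here bears on [IUTchIII] Cor. 3.12; no side taken.

**`⋉`-TWIN (cell row «LTIMES-SUCCESSOR», L4-lead m162; typing finding T3g9-F1).**  This file is the verbatim
re-elaboration of `LogFrobeniusMonoTelecoreObservablesShape.lean` over the successor interface `LogFrobeniusSettingLtimes`
(`Ltimes/LogFrobeniusCompatibility.lean`: `ι⊞_{v,ε}` indexed by the edges of `Γ⃗^⋉_v` at EVERY place, [AbsTopIII] Cor 5.5 (iii)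
p. 131), produced by the cell recipe `LTIMES-RECIPE.md`: names carry over inside `namespace LogFrobeniusSettingLtimes`, the
section variable is `Lt`, setting-independent declarations are NOT repeated (the originals are in scope), statements and
proofs are otherwise unchanged.  The original file over the frozen interface stays as it is.
SLICE T9 (abc-iut-f-101 gen 6): the rank/shape lemmas on `monoTeleShape` and `forgetArrow` are exported (the telecore shape is the
exported frozen one, `Ltimes/LogFrobeniusMonoTelecoreOver`); the three lemmas mentioning `plusToTS`/`embMonoPlus` (this namespace's
re-declarations) are re-proved.
-/

set_option autoImplicit false

universe u

open CategoryTheory Quiver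

namespace Literature.AnabelianGeometry.AbsoluteAnabelian

namespace LogFrobeniusSettingLtimes

export LogFrobeniusSetting (isObsMono rankV rank rank_le_of_hom rank_lt_of_hom rank_le_of_path length_eq_zero_of_rank false_of_path_obs monoJ_isEmpty_of_isHolomorphic forgetArrow rank_base_nplus rank_base_nv)

open DiagramOfCategories

variable {Vmod : Type u} {isArc : Vmod → Bool} (Lt : LogFrobeniusSettingLtimes Vmod isArc)

/-! ## The combinatorics of `Γ⃗_{D_{An⊢}}`: flagged vertices and a rank function -/

section Shape

end Shape

/-! ## The embeddings `Γ⃗(S_log⊞_v) ↪ Γ⃗_{D_{An⊢}} ↩ Γ⃗(S_log_v)` -/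

section Embeddings

variable (v : Vmod)

/-- The presentation `S_log⊞_v` IS `D_{An⊢}` pulled back along `embMonoPlus` (abc-iut-w5-d144's
`logDiagramPlus_eq_comapAlong_embMonoPlus` at the printed telecore edges). [cite: MochizukiAbsTopIII2015, Definition 3.5 (i) p.74] -/
theorem logDiagramPlus_eq_comapAlong :
    Lt.logDiagramPlus v = Lt.monoTeleDiagram.comapAlong (embMonoPlus (monoJ (Vmod := Vmod)) v) :=
  Lt.logDiagramPlus_eq_comapAlong_embMonoPlus monoJ v Lt.monoTelMap

/-- The presentation `S_log_v` IS `D_{An⊢}` pulled back along `embMonoTS` (abc-iut-w5-d144).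
[cite: MochizukiAbsTopIII2015, Definition 3.5 (i) p.74] -/
theorem logDiagramTS_eq_comapAlong :
    Lt.logDiagramTS v = Lt.monoTeleDiagram.comapAlong (embMonoTS (monoJ (Vmod := Vmod)) v) :=
  Lt.logDiagramTS_eq_comapAlong_embMonoTS monoJ v Lt.monoTelMap

/-- A family of `S_log⊞_v` read on the pulled-back presentation. [cite: MochizukiAbsTopIII2015, Definition 3.5 (ii) p.75] -/
def plusComap (H : (Lt.logDiagramPlus v).HomotopyFamily) :
    (Lt.monoTeleDiagram.comapAlong (embMonoPlus (monoJ (Vmod := Vmod)) v)).HomotopyFamily :=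
  Lt.logDiagramPlus_eq_comapAlong v ▸ H

/-- A family of `S_log_v` read on the pulled-back presentation. [cite: MochizukiAbsTopIII2015, Definition 3.5 (ii) p.75] -/
def tsComap (H : (Lt.logDiagramTS v).HomotopyFamily) :
    (Lt.monoTeleDiagram.comapAlong (embMonoTS (monoJ (Vmod := Vmod)) v)).HomotopyFamily :=
  Lt.logDiagramTS_eq_comapAlong v ▸ H

/-- Same boundary set. [cite: MochizukiAbsTopIII2015, Definition 3.5 (ii) p.75] -/
theorem plusComap_E_iff (H : (Lt.logDiagramPlus v).HomotopyFamily) {a b : (logShapePlus (isArc := isArc) v).Vertex}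
    (p q : Path a b) : (Lt.plusComap v H).E p q ↔ H.E p q :=
  DiagramOfCategories.HomotopyFamily.cast_E_iff _ H p q

/-- Same boundary set. [cite: MochizukiAbsTopIII2015, Definition 3.5 (ii) p.75] -/
theorem tsComap_E_iff (H : (Lt.logDiagramTS v).HomotopyFamily) {a b : (logShapeTS (isArc := isArc) v).Vertex}
    (p q : Path a b) : (Lt.tsComap v H).E p q ↔ H.E p q :=
  DiagramOfCategories.HomotopyFamily.cast_E_iff _ H p q

/-- Same homotopies (heterogeneously). [cite: MochizukiAbsTopIII2015, Definition 3.5 (ii) p.75] -/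
theorem plusComap_η_heq (H : (Lt.logDiagramPlus v).HomotopyFamily) {a b : (logShapePlus (isArc := isArc) v).Vertex}
    {p q : Path a b} (h : (Lt.plusComap v H).E p q) :
    HEq ((Lt.plusComap v H).η h) (H.η ((Lt.plusComap_E_iff v H p q).mp h)) :=
  DiagramOfCategories.HomotopyFamily.cast_η_heq _ H h

/-- Same homotopies (heterogeneously). [cite: MochizukiAbsTopIII2015, Definition 3.5 (ii) p.75] -/
theorem tsComap_η_heq (H : (Lt.logDiagramTS v).HomotopyFamily) {a b : (logShapeTS (isArc := isArc) v).Vertex}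
    {p q : Path a b} (h : (Lt.tsComap v H).E p q) :
    HEq ((Lt.tsComap v H).η h) (H.η ((Lt.tsComap_E_iff v H p q).mp h)) :=
  DiagramOfCategories.HomotopyFamily.cast_η_heq _ H h

/-- **A homotopy of `S_log⊞_v` read inside `D_{An⊢}`**: the homotopy of the embedded pair (on the path functors of `D_{An⊢}`).
[cite: MochizukiAbsTopIII2015, Cor 5.10 (iv)(b) p. 148] -/
noncomputable def embPlusHom (H : (Lt.logDiagramPlus v).HomotopyFamily) {a : (logShapePlus (isArc := isArc) v).Vertex}
    {p q : Path a (logShapePlus (isArc := isArc) v).obs} (h : H.E p q) :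
    Lt.monoTeleDiagram.pathFunctor ((embMonoPlus (monoJ (Vmod := Vmod)) v).mapPath p) ⟶
      Lt.monoTeleDiagram.pathFunctor ((embMonoPlus (monoJ (Vmod := Vmod)) v).mapPath q) :=
  (LiftPair.ofMem (F := embMonoPlus monoJ v) (D := Lt.monoTeleDiagram) (K := Lt.plusComap v H)
    ((Lt.plusComap_E_iff v H p q).mpr h)).hom

/-- Its components are those of the original homotopy (heterogeneously; all identifications are canonical).
[cite: MochizukiAbsTopIII2015, Cor 5.10 (iv)(b) p. 148] -/
theorem embPlusHom_app_heq (H : (Lt.logDiagramPlus v).HomotopyFamily) (x : DSub (DVertex.InFirstRows (isArc := isArc) 2))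
    {p q : Path ((logShapePlus (isArc := isArc) v).base x) (logShapePlus (isArc := isArc) v).obs} (h : H.E p q)
    (X : (Lt.logDiagramPlus v).obj ((logShapePlus (isArc := isArc) v).base x)) :
    HEq ((Lt.embPlusHom v H h).app X) ((H.η h).app X) := by
  have hD := Lt.logDiagramPlus_eq_comapAlong v
  rw [embPlusHom, LiftPair.hom_ofMem]
  simp only [NatTrans.comp_app, eqToHom_app]
  refine (DiagramOfCategories.HomotopyFamily.heq_eqToHom_comp_comp_eqToHom _ _ _).trans ?_
  exact NatTrans.app_heq_of_heq rfl HEq.rfl rfl HEq.rfl (DiagramOfCategories.pathFunctor_heq_of_eq hD p).symm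
    (DiagramOfCategories.pathFunctor_heq_of_eq hD q).symm (Lt.plusComap_η_heq v H _) HEq.rfl

/-- **A homotopy of `S_log_v` read inside `D_{An⊢}`**. [cite: MochizukiAbsTopIII2015, Cor 5.10 (iv)(b) p. 148] -/
noncomputable def embTSHom (H : (Lt.logDiagramTS v).HomotopyFamily) {a : (logShapeTS (isArc := isArc) v).Vertex}
    {p q : Path a (logShapeTS (isArc := isArc) v).obs} (h : H.E p q) :
    Lt.monoTeleDiagram.pathFunctor ((embMonoTS (monoJ (Vmod := Vmod)) v).mapPath p) ⟶
      Lt.monoTeleDiagram.pathFunctor ((embMonoTS (monoJ (Vmod := Vmod)) v).mapPath q) :=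
  (LiftPair.ofMem (F := embMonoTS monoJ v) (D := Lt.monoTeleDiagram) (K := Lt.tsComap v H)
    ((Lt.tsComap_E_iff v H p q).mpr h)).hom

/-- Its components are those of the original homotopy (heterogeneously). [cite: MochizukiAbsTopIII2015, Cor 5.10 (iv)(b) p. 148] -/
theorem embTSHom_app_heq (H : (Lt.logDiagramTS v).HomotopyFamily) (y : DSub (InPortionThree (isArc := isArc) v))
    {p q : Path ((logShapeTS (isArc := isArc) v).base y) (logShapeTS (isArc := isArc) v).obs} (h : H.E p q)
    (X : (Lt.logDiagramTS v).obj ((logShapeTS (isArc := isArc) v).base y)) :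
    HEq ((Lt.embTSHom v H h).app X) ((H.η h).app X) := by
  have hD := Lt.logDiagramTS_eq_comapAlong v
  rw [embTSHom, LiftPair.hom_ofMem]
  simp only [NatTrans.comp_app, eqToHom_app]
  refine (DiagramOfCategories.HomotopyFamily.heq_eqToHom_comp_comp_eqToHom _ _ _).trans ?_
  exact NatTrans.app_heq_of_heq rfl HEq.rfl rfl HEq.rfl (DiagramOfCategories.pathFunctor_heq_of_eq hD p).symm
    (DiagramOfCategories.pathFunctor_heq_of_eq hD q).symm (Lt.tsComap_η_heq v H _) HEq.rfl

end Embeddings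

/-! ## The `⊞`-paths pushed along `𝒩⊞_v → 𝒩_v`, inside `D_{An⊢}` -/

section PushPaths

variable (v : Vmod)

/-- `Path.cons` respects heterogeneous equality (bookkeeping). [folklore] -/
private theorem cons_heq {V₁ : Type*} [Quiver V₁] {a a' b b' c c' : V₁} (ha : a = a') (hb : b = b') (hc : c = c')
    (p : Path a b) (p' : Path a' b') (e : b ⟶ c) (e' : b' ⟶ c') (hp : HEq p p') (he : HEq e e') :
    HEq (p.cons e) (p'.cons e') := by
  subst ha hb hc; cases hp; cases he; rfl

/-- `Path.nil` respects equality of vertices (bookkeeping). [folklore] -/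
private theorem nil_heq {V₁ : Type*} [Quiver V₁] {a a' : V₁} (ha : a = a') : HEq (Path.nil : Path a a) (Path.nil : Path a' a') := by
  subst ha; rfl

/-- The two embeddings agree on `Γ⃗(S_log⊞_v) ⊆ Γ⃗(S_log_v)`: vertices. [cite: MochizukiAbsTopIII2015, Cor 5.10 (iv)(b) p. 148] -/
theorem embMonoTS_plusToTS_obj (a : (logShapePlus (isArc := isArc) v).Vertex) :
    (embMonoTS (monoJ (Vmod := Vmod)) v).obj ((LogFrobeniusSettingLtimes.plusToTS v).obj a) = (embMonoPlus (monoJ (Vmod := Vmod)) v).obj a := by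
  cases a <;> rfl

/-- … and paths (heterogeneously). [cite: MochizukiAbsTopIII2015, Cor 5.10 (iv)(b) p. 148] -/
theorem embMonoTS_plusToTS_mapPath_heq {a : (logShapePlus (isArc := isArc) v).Vertex} :
    ∀ {b : (logShapePlus (isArc := isArc) v).Vertex} (p : Path a b),
      HEq ((embMonoTS (monoJ (Vmod := Vmod)) v).mapPath ((LogFrobeniusSettingLtimes.plusToTS v).mapPath p))
        ((embMonoPlus (monoJ (Vmod := Vmod)) v).mapPath p)
  | _, Path.nil => nil_heq (embMonoTS_plusToTS_obj v a)
  | _, Path.cons (b := b) (c := c) p e => by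
    rw [Prefunctor.mapPath_cons, Prefunctor.mapPath_cons, Prefunctor.mapPath_cons]
    refine cons_heq (embMonoTS_plusToTS_obj v a) (embMonoTS_plusToTS_obj v b) (embMonoTS_plusToTS_obj v c) _ _ _ _
      (embMonoTS_plusToTS_mapPath_heq p) ?_
    cases b with
    | obs => cases c <;> exact (PEmpty.elim e)
    | base y =>
      cases c with
      | base z => rfl
      | obs => rfl

/-- **A `⊞`-path pushed along `𝒩⊞_v → 𝒩_v`, embedded, is the embedded `⊞`-path followed by the arrow `𝒩⊞_v → 𝒩_v` of `D_{An⊢}`.**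
[cite: MochizukiAbsTopIII2015, Cor 5.10 (iv)(b) p. 148] -/
theorem embMonoTS_mapPath_push (x : DSub (DVertex.InFirstRows (isArc := isArc) 2))
    (p : Path ((logShapePlus (isArc := isArc) v).base x) (logShapePlus (isArc := isArc) v).obs)
    (hn : monoBase (isArc := isArc) 6 (.nplus v)) (hm : monoBase (isArc := isArc) 6 (.nv v)) :
    (embMonoTS (monoJ (Vmod := Vmod)) v).mapPath (((LogFrobeniusSettingLtimes.plusToTS v).mapPath p).cons (forgetEdgeTS v)) =
      ((embMonoPlus (monoJ (Vmod := Vmod)) v).mapPath p).comp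
        ((Path.nil : Path ((monoTeleShape Vmod isArc).base ⟨.nplus v, hn⟩) _).cons (forgetArrow v hn hm)) := by
  rw [Prefunctor.mapPath_cons]
  exact eq_of_heq (cons_heq (embMonoTS_plusToTS_obj v _) rfl rfl _ _ _ _ (embMonoTS_plusToTS_mapPath_heq v p) HEq.rfl)

end PushPaths

end LogFrobeniusSettingLtimes

end Literature.AnabelianGeometry.AbsoluteAnabelian
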